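import Literature.Geometry.Lorentzian.MultiCentreRadiationZone

/-!
# Route EIHFluxBalance — `ModulatedKerrHandoff`, line `photon-rocket-modulation`: profile assembly

Helper file for the crux `stmt-FinalStateConjecture-10167`
(`Summit.FinalStateConjecture.FinalStateConjecture.Theses.EIHFluxBalance.ModulatedKerrHandoff`),
line `photon-rocket-modulation`, registered stub `stub_profileAssembly` (S3c, pure bookkeeping).

The line compares the MGHD metric in a lab chart with the INSTANTANEOUS modulated multi-Kerr–Schild
profile `G_inst = η + Σᵢ (instᵢ − η)` by first comparing it with the RETARDED-clock profile
`G_ret = η + Σᵢ (retᵢ − η)` and then matching the two profiles. The one-hole stub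
(`stub_oneHoleMatching`) gives, hole by hole, on the pinned late region
`U = {x⁰ > τ₀} ∖ ⋃ᵢ {ρᵢ ≤ rinᵢ}`:
(O1) the instantaneous summand is `C^∞` off its core; (O2) the retarded summand is `C^∞` off its
core after some time `Tᵢ`; (O3) the unweighted slab sup of `‖D^{≤3}(retᵢ − instᵢ)‖` tends to `0`;
(O4) the `(1 + dᵢ^{7/4})`-weighted cone-slab sup tends to `0` (`dᵢ = ‖x̲ − ξᵢ(t)‖`).
This file assembles the `N`-hole facts consumed by the transfer stub:
(P1) `G_inst` is `C^∞` on `U`; (P2) `G_ret` is `C^∞` on `U ∩ {x⁰ > T}`, `T = Σᵢ |Tᵢ| ≥ maxᵢ Tᵢ`;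
(P3) the unweighted `U`-slab sup of `‖D^{≤3}(G_ret − G_inst)‖` tends to `0`;
(P4) the `(1 + (minᵢ dᵢ)^{7/4})`-weighted cone-slab sup tends to `0`.

Proof: `G_ret − G_inst = Σᵢ (retᵢ − instᵢ)` pointwise (`profileAssembly_sub_eq_sum`); at points
where every summand is `Cᵐ`, `‖D^m Σᵢ fᵢ‖ₑ ≤ Σᵢ ‖D^m fᵢ‖ₑ`
(`Literature.Geometry.Lorentzian.enorm_iteratedFDeriv_sum_le`); each summand's term is below its
one-hole sup; `minᵢ dᵢ ≤ dⱼ` (`ciInf_le`) and `s ↦ √(√(s⁷))` is monotone on `[0, ∞)`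
(`profileAssembly_weight_le`); the sum of the one-hole sups tends to `0` (`tendsto_finsetSum`)
and the assembled sup is squeezed under it. Everything is first proved for abstract summands
`Fᵢ, Rᵢ : E4 → G` (`profileAssembly_of`) and then specialised verbatim to the boosted Kerr–Schild
summands. For `N = 0` all sums are empty and both profiles are `η`.

No spacetime geometry and no physics enter: finite sums, subadditivity of `iteratedFDeriv` at
smooth points, `iSup`/`ℝ≥0∞` bookkeeping. [folklore]
-/

noncomputable section

-- the doubled `FinalStateConjecture.FinalStateConjecture` path component trips dupNamespace
set_option linter.dupNamespace false

open scoped Manifold ContDiff Topology ENNReal BigOperators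
open Filter Set TopologicalSpace Literature.Geometry.Lorentzian

namespace Summit.FinalStateConjecture.FinalStateConjecture.Cruxes.ModulatedKerrHandoff.PhotonRocketModulation

/-! ### Pointwise algebra and order bookkeeping -/

/-- `(η + Σᵢ (Rᵢ − η)) − (η + Σᵢ (Fᵢ − η)) = Σᵢ (Rᵢ − Fᵢ)` pointwise: the difference of the two
assembled profiles is the sum of the one-hole differences. [folklore] -/
theorem profileAssembly_sub_eq_sum {E' G : Type*} [AddCommGroup G] {N : ℕ}
    (F R : Fin N → E' → G) (η : G) :
    (fun y ↦ (η + ∑ i, (R i y - η)) - (η + ∑ i, (F i y - η))) = fun y ↦ ∑ i, (R i y - F i y) := by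
  funext y
  rw [add_sub_add_left_eq_sub, ← Finset.sum_sub_distrib]
  exact Finset.sum_congr rfl fun i _ ↦ sub_sub_sub_cancel_right _ _ _

/-- The weight of the NEAREST centre is below the weight of ANY centre:
`1 + (minᵢ dᵢ)^{7/4} ≤ 1 + dⱼ^{7/4}` for nonnegative `dᵢ` (`ciInf_le`, monotonicity of
`s ↦ √(√(s⁷))` on `[0, ∞)`), in `ℝ≥0∞`. [folklore] -/
theorem profileAssembly_weight_le {N : ℕ} (d : Fin N → ℝ) (hd : ∀ i, 0 ≤ d i) (j : Fin N) :
    ENNReal.ofReal (1 + √(√((⨅ i, d i) ^ 7))) ≤ ENNReal.ofReal (1 + √(√(d j ^ 7))) := by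
  have h0 : 0 ≤ ⨅ i, d i := Real.iInf_nonneg hd
  have hle : ⨅ i, d i ≤ d j := ciInf_le ⟨0, Set.forall_mem_range.2 hd⟩ j
  exact ENNReal.ofReal_le_ofReal (add_le_add_right
    (Real.sqrt_le_sqrt (Real.sqrt_le_sqrt (pow_le_pow_left₀ h0 hle 7))) 1)

/-- One summand's unweighted term `‖D^m g(x)‖ₑ`, `m ≤ 3`, `x ∈ S`, is below the one-hole sup
`sup_{x ∈ S} sup_{m ≤ 3} ‖D^m g(x)‖ₑ`. [folklore] -/
theorem profileAssembly_term_le_sup {G : Type*} [NormedAddCommGroup G] [NormedSpace ℝ G]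
    (g : E4 → G) (S : Set E4) {x : E4} (hx : x ∈ S) {m : ℕ} (hm : m ≤ 3) :
    ‖iteratedFDeriv ℝ m g x‖ₑ ≤ ⨆ x ∈ S, ⨆ (m : ℕ) (_ : m ≤ 3), ‖iteratedFDeriv ℝ m g x‖ₑ :=
  (le_iSup₂ (f := fun (m : ℕ) (_ : m ≤ 3) ↦ ‖iteratedFDeriv ℝ m g x‖ₑ) m hm).trans
    (le_iSup₂ (f := fun x (_ : x ∈ S) ↦ ⨆ (m : ℕ) (_ : m ≤ 3), ‖iteratedFDeriv ℝ m g x‖ₑ) x hx)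

/-- One summand's weighted term `w(x) ‖D^m g(x)‖ₑ`, `m ≤ 3`, `x ∈ S`, is below the weighted
one-hole sup `sup_{x ∈ S} sup_{m ≤ 3} w(x) ‖D^m g(x)‖ₑ`. [folklore] -/
theorem profileAssembly_term_le_wsup {G : Type*} [NormedAddCommGroup G] [NormedSpace ℝ G]
    (g : E4 → G) (S : Set E4) (w : E4 → ℝ≥0∞) {x : E4} (hx : x ∈ S) {m : ℕ} (hm : m ≤ 3) :
    w x * ‖iteratedFDeriv ℝ m g x‖ₑ ≤
      ⨆ x ∈ S, ⨆ (m : ℕ) (_ : m ≤ 3), w x * ‖iteratedFDeriv ℝ m g x‖ₑ :=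
  (le_iSup₂ (f := fun (m : ℕ) (_ : m ≤ 3) ↦ w x * ‖iteratedFDeriv ℝ m g x‖ₑ) m hm).trans
    (le_iSup₂ (f := fun x (_ : x ∈ S) ↦ ⨆ (m : ℕ) (_ : m ≤ 3), w x * ‖iteratedFDeriv ℝ m g x‖ₑ)
      x hx)

/-! ### Assembly for abstract summands -/

/-- **Unweighted slab decay of a finite sum.** If every summand `gᵢ : E4 → G` is `Cᵐ` (`m ≤ 3`)
at the points of `U` later than `T`, every point of `U` is later than `τ₀` and good for every
hole, and each one-hole slab sup `sup_{x⁰ = t, x⁰ > τ₀, goodᵢ} sup_{m ≤ 3} ‖D^m gᵢ‖ₑ` tends to `0`,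
then the `U`-slab sup of `sup_{m ≤ 3} ‖D^m Σᵢ gᵢ‖ₑ` tends to `0`
(`‖D^m Σᵢ gᵢ‖ₑ ≤ Σᵢ ‖D^m gᵢ‖ₑ ≤ Σᵢ supᵢ`, `tendsto_finsetSum`, squeeze). [folklore] -/
theorem profileAssembly_tendsto_slab {G : Type*} [NormedAddCommGroup G] [NormedSpace ℝ G]
    {N : ℕ} (g : Fin N → E4 → G) (good : Fin N → E4 → Prop) (τ₀ T : ℝ) (U : Opens E4)
    (hmem : ∀ x : U, τ₀ < x.1 0 ∧ ∀ i, good i x.1)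
    (hg : ∀ i (x : U), T < x.1 0 → ∀ m : ℕ, m ≤ 3 → ContDiffAt ℝ m (g i) x.1)
    (h3 : ∀ i, Tendsto (fun t : ℝ ↦ ⨆ x ∈ {x : E4 | x 0 = t ∧ τ₀ < x 0 ∧ good i x},
      ⨆ (m : ℕ) (_ : m ≤ 3), ‖iteratedFDeriv ℝ m (g i) x‖ₑ) atTop (𝓝 0)) :
    Tendsto (fun t : ℝ ↦ ⨆ x ∈ {x : U | x.1 0 = t},
      ⨆ (m : ℕ) (_ : m ≤ 3), ‖iteratedFDeriv ℝ m (fun y ↦ ∑ i, g i y) x.1‖ₑ) atTop (𝓝 0) := by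
  have hlim := tendsto_finsetSum Finset.univ fun i _ ↦ h3 i
  rw [Finset.sum_const_zero] at hlim
  refine tendsto_of_tendsto_of_tendsto_of_le_of_le' tendsto_const_nhds hlim
    (Eventually.of_forall fun _ ↦ zero_le) ?_
  filter_upwards [eventually_gt_atTop T] with t ht
  refine iSup₂_le fun x hx ↦ iSup₂_le fun m hm ↦ ?_
  have hx0 : x.1 0 = t := hx
  have hTx : T < x.1 0 := lt_of_lt_of_eq ht hx0.symm
  refine (enorm_iteratedFDeriv_sum_le Finset.univ fun i _ ↦ hg i x hTx m hm).trans
    (Finset.sum_le_sum fun i _ ↦ ?_)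
  exact profileAssembly_term_le_sup (g i) {x : E4 | x 0 = t ∧ τ₀ < x 0 ∧ good i x}
    (show x.1 ∈ {x : E4 | x 0 = t ∧ τ₀ < x 0 ∧ good i x} from ⟨hx0, (hmem x).1, (hmem x).2 i⟩) hm

/-- **Weighted cone-slab decay of a finite sum.** As `profileAssembly_tendsto_slab`, on the cone
slabs `{x⁰ = t, |x̲| ≤ κt}` and with weights: the assembled sup carries the weight
`1 + (minᵢ ‖x̲ − ξᵢ(t)‖)^{7/4}` of the NEAREST centre, each one-hole sup its own weight
`1 + ‖x̲ − ξᵢ(t)‖^{7/4} ≥` the former (`profileAssembly_weight_le`); hence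
`w ‖D^m Σᵢ gᵢ‖ₑ ≤ Σᵢ w ‖D^m gᵢ‖ₑ ≤ Σᵢ wᵢ ‖D^m gᵢ‖ₑ ≤ Σᵢ supᵢ → 0`. [folklore] -/
theorem profileAssembly_tendsto_cone {G : Type*} [NormedAddCommGroup G] [NormedSpace ℝ G]
    {N : ℕ} (g : Fin N → E4 → G) (good : Fin N → E4 → Prop) (ξ : Fin N → ℝ → E3) (κ τ₀ T : ℝ)
    (U : Opens E4) (hmem : ∀ x : U, τ₀ < x.1 0 ∧ ∀ i, good i x.1)
    (hg : ∀ i (x : U), T < x.1 0 → ∀ m : ℕ, m ≤ 3 → ContDiffAt ℝ m (g i) x.1)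
    (h4 : ∀ i, Tendsto (fun t : ℝ ↦
      ⨆ x ∈ {x : E4 | x 0 = t ∧ E4.spatialNorm x ≤ κ * t ∧ τ₀ < x 0 ∧ good i x},
        ⨆ (m : ℕ) (_ : m ≤ 3), ENNReal.ofReal (1 + √(√(‖E4.spatial x - ξ i t‖ ^ 7))) *
          ‖iteratedFDeriv ℝ m (g i) x‖ₑ) atTop (𝓝 0)) :
    Tendsto (fun t : ℝ ↦ ⨆ x ∈ {x : U | x.1 0 = t ∧ E4.spatialNorm x.1 ≤ κ * t},
      ⨆ (m : ℕ) (_ : m ≤ 3), ENNReal.ofReal (1 + √(√((⨅ i, ‖E4.spatial x.1 - ξ i t‖) ^ 7))) *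
        ‖iteratedFDeriv ℝ m (fun y ↦ ∑ i, g i y) x.1‖ₑ) atTop (𝓝 0) := by
  have hlim := tendsto_finsetSum Finset.univ fun i _ ↦ h4 i
  rw [Finset.sum_const_zero] at hlim
  refine tendsto_of_tendsto_of_tendsto_of_le_of_le' tendsto_const_nhds hlim
    (Eventually.of_forall fun _ ↦ zero_le) ?_
  filter_upwards [eventually_gt_atTop T] with t ht
  refine iSup₂_le fun x hx ↦ iSup₂_le fun m hm ↦ ?_
  have hx0 : x.1 0 = t := hx.1
  have hxc : E4.spatialNorm x.1 ≤ κ * t := hx.2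
  have hTx : T < x.1 0 := lt_of_lt_of_eq ht hx0.symm
  have hw : ∀ i, ENNReal.ofReal (1 + √(√((⨅ i, ‖E4.spatial x.1 - ξ i t‖) ^ 7))) ≤
      ENNReal.ofReal (1 + √(√(‖E4.spatial x.1 - ξ i t‖ ^ 7))) := fun i ↦
    profileAssembly_weight_le (fun i ↦ ‖E4.spatial x.1 - ξ i t‖) (fun i ↦ norm_nonneg _) i
  calc ENNReal.ofReal (1 + √(√((⨅ i, ‖E4.spatial x.1 - ξ i t‖) ^ 7))) *
        ‖iteratedFDeriv ℝ m (fun y ↦ ∑ i, g i y) x.1‖ₑ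
      ≤ ENNReal.ofReal (1 + √(√((⨅ i, ‖E4.spatial x.1 - ξ i t‖) ^ 7))) *
          ∑ i, ‖iteratedFDeriv ℝ m (g i) x.1‖ₑ :=
        mul_le_mul_right (enorm_iteratedFDeriv_sum_le Finset.univ fun i _ ↦ hg i x hTx m hm) _
    _ = ∑ i, ENNReal.ofReal (1 + √(√((⨅ i, ‖E4.spatial x.1 - ξ i t‖) ^ 7))) *
          ‖iteratedFDeriv ℝ m (g i) x.1‖ₑ := Finset.mul_sum _ _ _
    _ ≤ ∑ i, ENNReal.ofReal (1 + √(√(‖E4.spatial x.1 - ξ i t‖ ^ 7))) *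
          ‖iteratedFDeriv ℝ m (g i) x.1‖ₑ :=
        Finset.sum_le_sum fun i _ ↦ mul_le_mul_left (hw i) _
    _ ≤ ∑ i, ⨆ x ∈ {x : E4 | x 0 = t ∧ E4.spatialNorm x ≤ κ * t ∧ τ₀ < x 0 ∧ good i x},
          ⨆ (m : ℕ) (_ : m ≤ 3), ENNReal.ofReal (1 + √(√(‖E4.spatial x - ξ i t‖ ^ 7))) *
            ‖iteratedFDeriv ℝ m (g i) x‖ₑ :=
        Finset.sum_le_sum fun i _ ↦ profileAssembly_term_le_wsup (g i)
          {x : E4 | x 0 = t ∧ E4.spatialNorm x ≤ κ * t ∧ τ₀ < x 0 ∧ good i x}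
          (fun x ↦ ENNReal.ofReal (1 + √(√(‖E4.spatial x - ξ i t‖ ^ 7))))
          (show x.1 ∈ {x : E4 | x 0 = t ∧ E4.spatialNorm x ≤ κ * t ∧ τ₀ < x 0 ∧ good i x} from
            ⟨hx0, hxc, (hmem x).1, (hmem x).2 i⟩) hm

/-- **Profile assembly for abstract summands.** For `N` holes with instantaneous summands `Fᵢ`,
retarded summands `Rᵢ : E4 → G`, a constant `η`, goodness predicates `goodᵢ` (`ρᵢ > rinᵢ`) and
the pinned late region `U = {x⁰ > τ₀, ∀ i goodᵢ}`: the one-hole facts (O1)–(O4) imply the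
`N`-hole facts (P1)–(P4) for `η + Σᵢ (Fᵢ − η)` and `η + Σᵢ (Rᵢ − η)` (module docstring).
[folklore] -/
theorem profileAssembly_of {G : Type*} [NormedAddCommGroup G] [NormedSpace ℝ G] {N : ℕ}
    (F R : Fin N → E4 → G) (η : G) (good : Fin N → E4 → Prop) (ξ : Fin N → ℝ → E3)
    (κ τ₀ : ℝ) (U : Opens E4) (hU : (U : Set E4) = {x : E4 | τ₀ < x 0 ∧ ∀ i, good i x})
    (h1 : ∀ i, ∀ x : E4, good i x → ContDiffAt ℝ ∞ (fun y ↦ F i y - η) x)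
    (h2 : ∀ i, ∃ T : ℝ, ∀ x : E4, T < x 0 → good i x → ContDiffAt ℝ ∞ (fun y ↦ R i y - η) x)
    (h3 : ∀ i, Tendsto (fun t : ℝ ↦ ⨆ x ∈ {x : E4 | x 0 = t ∧ τ₀ < x 0 ∧ good i x},
      ⨆ (m : ℕ) (_ : m ≤ 3), ‖iteratedFDeriv ℝ m (fun y ↦ R i y - F i y) x‖ₑ) atTop (𝓝 0))
    (h4 : ∀ i, Tendsto (fun t : ℝ ↦
      ⨆ x ∈ {x : E4 | x 0 = t ∧ E4.spatialNorm x ≤ κ * t ∧ τ₀ < x 0 ∧ good i x},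
        ⨆ (m : ℕ) (_ : m ≤ 3), ENNReal.ofReal (1 + √(√(‖E4.spatial x - ξ i t‖ ^ 7))) *
          ‖iteratedFDeriv ℝ m (fun y ↦ R i y - F i y) x‖ₑ) atTop (𝓝 0)) :
    (∀ x : U, ContDiffAt ℝ ∞ (fun y ↦ η + ∑ i, (F i y - η)) x.1) ∧
    (∃ T : ℝ, ∀ x : U, T < x.1 0 → ContDiffAt ℝ ∞ (fun y ↦ η + ∑ i, (R i y - η)) x.1) ∧
    Tendsto (fun t : ℝ ↦ ⨆ x ∈ {x : U | x.1 0 = t}, ⨆ (m : ℕ) (_ : m ≤ 3),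
      ‖iteratedFDeriv ℝ m (fun y ↦ (η + ∑ i, (R i y - η)) - (η + ∑ i, (F i y - η))) x.1‖ₑ)
      atTop (𝓝 0) ∧
    Tendsto (fun t : ℝ ↦ ⨆ x ∈ {x : U | x.1 0 = t ∧ E4.spatialNorm x.1 ≤ κ * t},
      ⨆ (m : ℕ) (_ : m ≤ 3), ENNReal.ofReal (1 + √(√((⨅ i, ‖E4.spatial x.1 - ξ i t‖) ^ 7))) *
        ‖iteratedFDeriv ℝ m (fun y ↦ (η + ∑ i, (R i y - η)) - (η + ∑ i, (F i y - η))) x.1‖ₑ)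
      atTop (𝓝 0) := by
  have hmem : ∀ x : U, τ₀ < x.1 0 ∧ ∀ i, good i x.1 := fun x ↦ by
    have hx : x.1 ∈ (U : Set E4) := x.2
    rw [hU] at hx
    exact hx
  choose T hT using h2
  have hTle : ∀ i, T i ≤ ∑ j, |T j| := fun i ↦ (le_abs_self _).trans
    (Finset.single_le_sum (f := fun j ↦ |T j|) (fun _ _ ↦ abs_nonneg _) (Finset.mem_univ i))
  have hg : ∀ i (x : U), ∑ j, |T j| < x.1 0 → ∀ m : ℕ, m ≤ 3 →
      ContDiffAt ℝ m (fun y ↦ R i y - F i y) x.1 := by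
    intro i x hx m _
    have hfun : (fun y ↦ R i y - F i y) = fun y ↦ (R i y - η) - (F i y - η) :=
      funext fun y ↦ (sub_sub_sub_cancel_right _ _ _).symm
    rw [hfun]
    exact ((hT i x.1 ((hTle i).trans_lt hx) ((hmem x).2 i)).sub (h1 i x.1 ((hmem x).2 i))).of_le
      (by exact_mod_cast le_top)
  have hΔ := profileAssembly_sub_eq_sum F R η
  refine ⟨fun x ↦ ?_, ⟨∑ j, |T j|, fun x hx ↦ ?_⟩, ?_, ?_⟩
  · exact contDiffAt_const.add (ContDiffAt.sum fun i _ ↦ h1 i x.1 ((hmem x).2 i))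
  · exact contDiffAt_const.add
      (ContDiffAt.sum fun i _ ↦ hT i x.1 ((hTle i).trans_lt hx) ((hmem x).2 i))
  · rw [hΔ]
    exact profileAssembly_tendsto_slab (fun i y ↦ R i y - F i y) good τ₀ _ U hmem hg h3
  · rw [hΔ]
    exact profileAssembly_tendsto_cone (fun i y ↦ R i y - F i y) good ξ κ τ₀ _ U hmem hg h4

/-! ### The registered stub -/

/-- S3c · PROFILE ASSEMBLY (registered stub of the line `photon-rocket-modulation`, crux
`EIHFluxBalance.ModulatedKerrHandoff`; bookkeeping). For `N` holes with clocks `Ucᵢ`,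
instantaneous Kerr–Schild radii `ρᵢ`, core radii `rinᵢ` and the pinned late region
`U = {x⁰ > τ₀} ∖ ⋃ᵢ {ρᵢ ≤ rinᵢ}`: IF every hole satisfies the four one-hole conclusions of
`stub_oneHoleMatching` (instantaneous summand smooth off its core; retarded summand eventually
smooth off its core; unweighted and `(1 + dᵢ^{7/4})`-weighted `C^{≤3}` decay of the one-hole
difference), THEN the `N`-hole profiles `G_inst = η + Σᵢ(instᵢ − η)`, `G_ret = η + Σᵢ(retᵢ − η)`
satisfy: `G_inst` is `C^∞` at every point of `U`; `G_ret` is `C^∞` at every point of `U` with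
`x⁰ > T`; the unweighted `U`-slab sup and the `(1 + (minᵢ dᵢ)^{7/4})`-weighted cone-slab sup of
`‖D^m(G_ret − G_inst)‖`, `m ≤ 3`, tend to `0`. Proof: `profileAssembly_of` specialised to the
boosted Kerr–Schild summands. [folklore] -/
theorem stub_profileAssembly :
    ∀ (N : ℕ) (M a rin : Fin N → ℝ) (Mf : Fin N → ℝ → ℝ) (Λ : Fin N → ℝ → lorentzGroup) (ξ : Fin N → ℝ → E3) (Uc ρ : Fin N → E4 → ℝ) (κ τ₀ : ℝ) (U : Opens E4),
        (U : Set E4) = {x : E4 | τ₀ < x 0 ∧ ∀ i, rin i < ρ i x} →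
        (∀ i,
          (∀ x : E4, rin i < ρ i x → ContDiffAt ℝ ((⊤ : ℕ∞) : WithTop ℕ∞) (fun y ↦ boostedKerrBilin (Λ i (y 0)) (E4.ofTimeSpace (y 0) (ξ i (y 0))) (M i) (a i) y - Minkowski.bilin) x) ∧
          (∃ T : ℝ, ∀ x : E4, T < x 0 → rin i < ρ i x → ContDiffAt ℝ ((⊤ : ℕ∞) : WithTop ℕ∞) (fun y ↦ boostedKerrBilin (Λ i (Uc i y)) (E4.ofTimeSpace (Uc i y) (ξ i (Uc i y))) (Mf i (Uc i y)) (a i) y - Minkowski.bilin) x) ∧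
          Tendsto (fun t : ℝ ↦ ⨆ x ∈ {x : E4 | x 0 = t ∧ τ₀ < x 0 ∧ rin i < ρ i x}, ⨆ (m : ℕ) (_ : m ≤ 3), ‖iteratedFDeriv ℝ m (fun y ↦ boostedKerrBilin (Λ i (Uc i y)) (E4.ofTimeSpace (Uc i y) (ξ i (Uc i y))) (Mf i (Uc i y)) (a i) y - boostedKerrBilin (Λ i (y 0)) (E4.ofTimeSpace (y 0) (ξ i (y 0))) (M i) (a i) y) x‖ₑ) atTop (𝓝 0) ∧
          Tendsto (fun t : ℝ ↦ ⨆ x ∈ {x : E4 | x 0 = t ∧ E4.spatialNorm x ≤ κ * t ∧ τ₀ < x 0 ∧ rin i < ρ i x}, ⨆ (m : ℕ) (_ : m ≤ 3), ENNReal.ofReal (1 + √(√(‖E4.spatial x - ξ i t‖ ^ 7))) * ‖iteratedFDeriv ℝ m (fun y ↦ boostedKerrBilin (Λ i (Uc i y)) (E4.ofTimeSpace (Uc i y) (ξ i (Uc i y))) (Mf i (Uc i y)) (a i) y - boostedKerrBilin (Λ i (y 0)) (E4.ofTimeSpace (y 0) (ξ i (y 0))) (M i) (a i) y) x‖ₑ)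 atTop (𝓝 0)) →
          (∀ x : U, ContDiffAt ℝ ((⊤ : ℕ∞) : WithTop ℕ∞) (fun y ↦ Minkowski.bilin + ∑ i, (boostedKerrBilin (Λ i (y 0)) (E4.ofTimeSpace (y 0) (ξ i (y 0))) (M i) (a i) y - Minkowski.bilin)) x.1) ∧
          (∃ T : ℝ, ∀ x : U, T < x.1 0 → ContDiffAt ℝ ((⊤ : ℕ∞) : WithTop ℕ∞) (fun y ↦ Minkowski.bilin + ∑ i, (boostedKerrBilin (Λ i (Uc i y)) (E4.ofTimeSpace (Uc i y) (ξ i (Uc i y))) (Mf i (Uc i y)) (a i) y - Minkowski.bilin)) x.1) ∧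
          Tendsto (fun t : ℝ ↦ ⨆ x ∈ {x : U | x.1 0 = t}, ⨆ (m : ℕ) (_ : m ≤ 3), ‖iteratedFDeriv ℝ m (fun y ↦ (Minkowski.bilin + ∑ i, (boostedKerrBilin (Λ i (Uc i y)) (E4.ofTimeSpace (Uc i y) (ξ i (Uc i y))) (Mf i (Uc i y)) (a i) y - Minkowski.bilin)) - (Minkowski.bilin + ∑ i, (boostedKerrBilin (Λ i (y 0)) (E4.ofTimeSpace (y 0) (ξ i (y 0))) (M i) (a i) y - Minkowski.bilin))) x.1‖ₑ) atTop (𝓝 0) ∧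
          Tendsto (fun t : ℝ ↦ ⨆ x ∈ {x : U | x.1 0 = t ∧ E4.spatialNorm x.1 ≤ κ * t}, ⨆ (m : ℕ) (_ : m ≤ 3), ENNReal.ofReal (1 + √(√((⨅ i, ‖E4.spatial x.1 - ξ i t‖) ^ 7))) * ‖iteratedFDeriv ℝ m (fun y ↦ (Minkowski.bilin + ∑ i, (boostedKerrBilin (Λ i (Uc i y)) (E4.ofTimeSpace (Uc i y) (ξ i (Uc i y))) (Mf i (Uc i y)) (a i) y - Minkowski.bilin)) - (Minkowski.bilin + ∑ i, (boostedKerrBilin (Λ i (y 0)) (E4.ofTimeSpace (y 0) (ξ i (y 0))) (M i) (a i) y - Minkowski.bilin))) x.1‖ₑ) atTop (𝓝 0) := by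
  intro N M a rin Mf Λ ξ Uc ρ κ τ₀ U hU hO
  exact profileAssembly_of
    (fun i y ↦ boostedKerrBilin (Λ i (y 0)) (E4.ofTimeSpace (y 0) (ξ i (y 0))) (M i) (a i) y)
    (fun i y ↦ boostedKerrBilin (Λ i (Uc i y)) (E4.ofTimeSpace (Uc i y) (ξ i (Uc i y)))
      (Mf i (Uc i y)) (a i) y)
    Minkowski.bilin (fun i x ↦ rin i < ρ i x) ξ κ τ₀ U hU (fun i ↦ (hO i).1) (fun i ↦ (hO i).2.1)
    (fun i ↦ (hO i).2.2.1) (fun i ↦ (hO i).2.2.2)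

end Summit.FinalStateConjecture.FinalStateConjecture.Cruxes.ModulatedKerrHandoff.PhotonRocketModulation

end
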